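/-
Copyright (c) 2026 the pub-hodgecm-mathlib formalisation cell (harness21).  Prover seat hodgecm-mathlib-K2E3-p11 (g2), Track B «K2-LIT» ∕ h413,
unit U12 «Characters» of the line `K2_E3_EllipticInputs`, socket #11 `sig_K2E3CharLocIntNearSemisimple`, road (11-SC): the JOINT PROPERNESS of
`(x, g) ↦ x g x⁻¹` over conjugates of a compact set of regular elements with compact centraliser — the hypothesis `hprop` of ★
`K2E3SupercuspidalCharacterOrbitalIntegral`, on the socket's groups at non-split places.  2026-09-04.
-/
import Literature.NumberTheory.Automorphic.ConjugationProperOnRegularCompactaLocal   -- ★ `isCompact_image_mk_setOf_exists_conj_mem_cmDatum_local` (Harish-Chandra's Lemma 14, CM carriers)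
import Literature.NumberTheory.Automorphic.OrbitalIntegralSupportLocalisation        -- ★ `isCompact_preimage_mk_of_isCompact` (quotient by a compact subgroup is proper)
import Literature.NumberTheory.Automorphic.UnitaryGroupPureTensorEulerProduct         -- ★ `locallyCompactSpace_gl_adicCompletion`, `secondCountableTopology_gl_adicCompletion`
import Literature.NumberTheory.Automorphic.LocalUnitaryGroupCongrMeasure              -- ★ instances on `(cmDatum L N H).Local v` (locally compact, T₂, second countable)
import HarnessLib

/-!
# K2_E3 road (h413 = stmt-HodgeConjecture-24833), unit U12 «Characters», socket #11, road (11-SC) — JOINT PROPERNESS OF CONJUGATION: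
# `{(x, g) : g ∈ C₀, x g x⁻¹ ∈ S}` is compact when `C₀ ⊆ Y·K·Y⁻¹` with `Y` compact and `K` a compact set of regular elements of a compact Cartan subgroup

Cell `pub/hodgecm-mathlib` (D-0151), Track B (21-frontier RULING «PUSH BOTH» 2026-09-03), socket module
`Summits/HodgeConjecture/HodgeConjecture/Cruxes/H413/Lines/K2_E3_EllipticInputsSigs_U12Characters.lean` (ED. 5), socket **`sig_K2E3CharLocIntNearSemisimple`**
(SIGS-TABLE-K2E3 row #11, XL), road (11-SC) (seat memo §6; Harish-Chandra 1970 Thm 16 for supercuspidal classes).  `--supports stmt-HodgeConjecture-24833 --as helper`;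
theorems only — no `def`, no named fact, no instance, no notation, no `sorry`.

WHAT.  ★ `K2E3SupercuspidalCharacterOrbitalIntegral.integral_mul_orbitalCoeff_eq` (this seat) interchanges the integrals of Harish-Chandra's Theorem 9 under the
hypothesis that `P(C₀, S) := {(x, g) ∈ G × G : g ∈ C₀, x g x⁻¹ ∈ S}` is COMPACT (`C₀ = supp φ`, `S = supp` of the coefficient).  This file supplies that
hypothesis where print uses it — on the regular ELLIPTIC set [HarishChandra1970, Part I §3 Lemma 14; Part V Lemma 19 and its Corollary «`(x*, k) ↦ θ(γ^{xk})` has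
compact support in `G∕Z × K₀`»]:
* §1 (generic locally compact `G`, `T ≤ G` a COMPACT subgroup): if the image in `G ∕ T` of `A(K, S) := {z : ∃ t ∈ K, z t z⁻¹ ∈ S}` is compact (Harish-Chandra's Lemma 14,
  the hypothesis `hA`), then `A(K, S)` lies in the compact `mk⁻¹(mk(A))` (★ `isCompact_preimage_mk_of_isCompact`), and for `C₀ ⊆ {y t y⁻¹ : y ∈ Y, t ∈ K}` with
  `Y`, `C₀` compact and `S` closed, `P(C₀, S) ⊆ (mk⁻¹(mk A)·Y⁻¹) × C₀` is a closed subset of a compact set (`x (y t y⁻¹) x⁻¹ = (xy) t (xy)⁻¹`):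
  **`isCompact_setOf_mem_and_conj_mem`**.
* §2 (the socket's group `G = U_N(H)(L⁺_v) = (cmDatum L N H).Local v` at a NON-SPLIT `v`, every `N`): for `γ` regular with COMPACT centraliser `T = Z(γ)` (an elliptic
  Cartan subgroup), `K ⊆ T` compact and regular, `Y` compact, `C₀ ⊆ Y·K·Y⁻¹` compact and `S` compact, **`P(C₀, S)` is compact**
  (**`isCompact_setOf_mem_and_conj_mem_cmDatum_local`**) — `hA` is ★ `isCompact_image_mk_setOf_exists_conj_mem_cmDatum_local` (Lemma 14 on the CM carriers).
  With `C₀ = tsupport φ` and `S = tsupport (y ↦ B v (ρ y v))` this is exactly the `hprop` of ★ `integral_mul_orbitalCoeff_eq` ∕ `smoothTrace_eq_integral_mul_orbitalCoeff`: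
  so on test functions supported in `Y·K·Y⁻¹` (a typical compact piece of the regular elliptic set) the character of a supercuspidal class of `U_N(H)(L⁺_v)` IS the
  orbital integral of a normalised coefficient — Harish-Chandra's `Θ_ω(γ) = d(ω)∫ θ(γ^x)` [1970, p. 68] — the first rung of road (11-SC) and of U5 #15's Theorem 17.

* §1 (private `conj_conj_eq`), `subset_preimage_image_mk`, **`isCompact_setOf_mem_and_conj_mem`** (generic).
* §2 **`isCompact_setOf_mem_and_conj_mem_cmDatum_local`** (CM carriers, non-split `v`).

HONEST LABEL: HC_CM is proved only modulo the 7 printed citations (2 remaining named inputs: hLiu418 = stmt-HodgeConjecture-24832, h413 =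
stmt-HodgeConjecture-24833) until rung 0 closes; this file is an unconditional `--supports` helper (a topological lemma) and proves no character identity by itself.

## References
* [HarishChandra1970] Harish-Chandra (notes by G. van Dijk), *Harmonic Analysis on Reductive p-adic Groups*, LNM 162 (1970), Part I §3 Lemma 14; Part V §1 Lemma 19
  and Corollary, p. 68.
* [Rogawski1990] J. D. Rogawski, *Automorphic Representations of Unitary Groups in Three Variables*, Ann. of Math. Stud. 123 (1990), §4.9 p. 54 (orbital integrals
  of regular elements), §3.1 p. 19.
-/

set_option autoImplicit false
set_option linter.dupNamespace false

noncomputable section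

open Topology NumberField IsDedekindDomain
open Literature.NumberTheory.Automorphic Literature.NumberTheory.Rogawski1990
open scoped Matrix MatrixGroups Pointwise

namespace Summit.HodgeConjecture.HodgeConjecture.Cruxes.H413.K2E3ConjugationJointProperness

/-! ## §1  Generic: joint properness from Harish-Chandra's Lemma 14 and a compact centraliser -/

section Generic

variable {G : Type*} [Group G] [TopologicalSpace G] [IsTopologicalGroup G] [LocallyCompactSpace G] [T2Space G]

omit [TopologicalSpace G] [IsTopologicalGroup G] [LocallyCompactSpace G] [T2Space G] in
/-- `x (y t y⁻¹) x⁻¹ = (x y) t (x y)⁻¹`. [folklore] -/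
private theorem conj_conj_eq (x y t : G) : x * (y * t * y⁻¹) * x⁻¹ = (x * y) * t * (x * y)⁻¹ := by
  simp only [mul_inv_rev, mul_assoc]

omit [TopologicalSpace G] [IsTopologicalGroup G] [LocallyCompactSpace G] [T2Space G] in
/-- A set is contained in the preimage of its image in `G ∕ T`. [folklore] -/
theorem subset_preimage_image_mk (T : Subgroup G) (A : Set G) :
    A ⊆ (QuotientGroup.mk : G → G ⧸ T) ⁻¹' ((QuotientGroup.mk : G → G ⧸ T) '' A) :=
  fun a ha => ⟨a, ha, rfl⟩

/-- **JOINT PROPERNESS OF CONJUGATION (generic).**  Let `T ≤ G` be a COMPACT subgroup, `K, S, Y, C₀ ⊆ G` with `Y`, `C₀` compact, `S` closed and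
`C₀ ⊆ {y t y⁻¹ : y ∈ Y, t ∈ K}`.  If the image of `A := {z : ∃ t ∈ K, z t z⁻¹ ∈ S}` in `G ∕ T` is compact (Harish-Chandra's Lemma 14), then
`{(x, g) : g ∈ C₀, x g x⁻¹ ∈ S}` is a COMPACT subset of `G × G`: it is closed, and contained in `(mk⁻¹(mk A) · Y⁻¹) × C₀` (for `g = y t y⁻¹`, `x g x⁻¹ = (xy) t (xy)⁻¹ ∈ S`
gives `x y ∈ A`), where `mk⁻¹(mk A)` is compact because `T` is (★ `isCompact_preimage_mk_of_isCompact`).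
[cite: HarishChandra1970, Part I §3 Lemma 14; Part V §1 Lemma 19 and Corollary] -/
theorem isCompact_setOf_mem_and_conj_mem (T : Subgroup G) (hT : IsCompact (T : Set G)) {K S Y C₀ : Set G}
    (hA : IsCompact ((QuotientGroup.mk : G → G ⧸ T) '' {z : G | ∃ t ∈ K, z * t * z⁻¹ ∈ S}))
    (hS : IsClosed S) (hY : IsCompact Y) (hC₀ : IsCompact C₀) (hsub : C₀ ⊆ {g : G | ∃ y ∈ Y, ∃ t ∈ K, g = y * t * y⁻¹}) :
    IsCompact {p : G × G | p.2 ∈ C₀ ∧ p.1 * p.2 * p.1⁻¹ ∈ S} := by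
  -- the compact hull `A' = mk⁻¹(mk A)` of `A`
  set A : Set G := {z : G | ∃ t ∈ K, z * t * z⁻¹ ∈ S} with hA_def
  have hA' : IsCompact ((QuotientGroup.mk : G → G ⧸ T) ⁻¹' ((QuotientGroup.mk : G → G ⧸ T) '' A)) :=
    isCompact_preimage_mk_of_isCompact T hT hA
  -- the compact box `(A'·Y⁻¹) × C₀`
  have hbox : IsCompact (((fun q : G × G => q.1 * q.2⁻¹) '' (((QuotientGroup.mk : G → G ⧸ T) ⁻¹' ((QuotientGroup.mk : G → G ⧸ T) '' A)) ×ˢ Y)) ×ˢ C₀) :=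
    ((hA'.prod hY).image (continuous_fst.mul continuous_snd.inv)).prod hC₀
  -- closedness
  have hclosed : IsClosed {p : G × G | p.2 ∈ C₀ ∧ p.1 * p.2 * p.1⁻¹ ∈ S} := by
    have h1 : IsClosed {p : G × G | p.2 ∈ C₀} := hC₀.isClosed.preimage continuous_snd
    have h2 : IsClosed {p : G × G | p.1 * p.2 * p.1⁻¹ ∈ S} :=
      hS.preimage ((continuous_fst.mul continuous_snd).mul continuous_fst.inv)
    exact h1.inter h2
  refine hbox.of_isClosed_subset hclosed ?_
  rintro ⟨x, g⟩ ⟨hg, hxg⟩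
  refine Set.mk_mem_prod ?_ hg
  obtain ⟨y, hy, t, ht, rfl⟩ := hsub hg
  have hxy : x * y ∈ A := ⟨t, ht, by rw [← conj_conj_eq]; exact hxg⟩
  refine ⟨(x * y, y), Set.mk_mem_prod (subset_preimage_image_mk T A hxy) hy, ?_⟩
  simp only [mul_inv_cancel_right]

end Generic

/-! ## §2  The socket's group `U_N(H)(L⁺_v)` at a non-split place: regular elliptic elements -/

section CM

variable (L : Type) [Field L] [NumberField L] [IsCMField L] (N : ℕ) (H : Matrix (Fin N) (Fin N) L)
  {v : HeightOneSpectrum (𝓞 ↥(maximalRealSubfield L))}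

open scoped Classical in
/-- **JOINT PROPERNESS ON THE REGULAR ELLIPTIC SET OF `U_N(H)(L⁺_v)` (non-split `v`, every `N`).**  Let `γ ∈ G = (cmDatum L N H).Local v` be regular semisimple with
COMPACT centraliser `Z(γ)` (an elliptic Cartan subgroup), `K ⊆ Z(γ)` a compact set of regular elements, `Y ⊆ G` compact, `C₀ ⊆ {y t y⁻¹ : y ∈ Y, t ∈ K}` compact and
`S ⊆ G` compact.  Then `{(x, g) : g ∈ C₀, x g x⁻¹ ∈ S}` is compact — §1 over Harish-Chandra's Lemma 14 on the CM carriers (★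
`isCompact_image_mk_setOf_exists_conj_mem_cmDatum_local`).  With `C₀ = tsupport φ`, `S = tsupport (y ↦ B v (ρ y v))` this is the hypothesis `hprop` of ★
`K2E3SupercuspidalCharacterOrbitalIntegral.integral_mul_orbitalCoeff_eq`: on test functions supported in `Y·K·Y⁻¹` the character of a supercuspidal class of `G` is
the orbital integral of a normalised matrix coefficient. [cite: HarishChandra1970, Part I §3 Lemma 14; Part V §1 Lemma 19, p. 68] [cite: Rogawski1990, §4.9 p. 54] -/
theorem isCompact_setOf_mem_and_conj_mem_cmDatum_local (hH : (H.map (cmConjRingHom L))ᵀ = H) (hHd : IsUnit H.det)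
    (w : UnitaryGroup.PlacesOver L v) (hw : IsCMField.complexConj L • w.1 = w.1)
    (γ : (UnitaryGroup.cmDatum L N H).Local v) (hγ : IsRegularElt (γ.val : GL (Fin N) (UnitaryGroup.LocalRing L v)))
    (hZ : IsCompact ((Subgroup.centralizer ({γ} : Set ((UnitaryGroup.cmDatum L N H).Local v)) : Set ((UnitaryGroup.cmDatum L N H).Local v))))
    {K S Y C₀ : Set ((UnitaryGroup.cmDatum L N H).Local v)} (hK : IsCompact K)
    (hKZ : K ⊆ Subgroup.centralizer ({γ} : Set ((UnitaryGroup.cmDatum L N H).Local v)))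
    (hKreg : ∀ t ∈ K, IsRegularElt (t.val : GL (Fin N) (UnitaryGroup.LocalRing L v)))
    (hS : IsCompact S) (hY : IsCompact Y) (hC₀ : IsCompact C₀)
    (hsub : C₀ ⊆ {g : (UnitaryGroup.cmDatum L N H).Local v | ∃ y ∈ Y, ∃ t ∈ K, g = y * t * y⁻¹}) :
    IsCompact {p : (UnitaryGroup.cmDatum L N H).Local v × (UnitaryGroup.cmDatum L N H).Local v | p.2 ∈ C₀ ∧ p.1 * p.2 * p.1⁻¹ ∈ S} := by
  haveI : LocallyCompactSpace (GL (Fin N) (w.1.adicCompletion L)) := UnitaryGroup.locallyCompactSpace_gl_adicCompletion L N w.1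
  haveI : SecondCountableTopology (GL (Fin N) (w.1.adicCompletion L)) := UnitaryGroup.secondCountableTopology_gl_adicCompletion L N w.1
  have hA := UnitaryGroup.isCompact_image_mk_setOf_exists_conj_mem_cmDatum_local L N H hH hHd w hw γ hγ hK hKZ hKreg hS
  exact isCompact_setOf_mem_and_conj_mem (Subgroup.centralizer ({γ} : Set ((UnitaryGroup.cmDatum L N H).Local v))) hZ hA hS.isClosed hY hC₀ hsub

end CM

end Summit.HodgeConjecture.HodgeConjecture.Cruxes.H413.K2E3ConjugationJointProperness

end
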